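import Summits.QuantumFields.YangMills.Theses.ColdBoxAllGroups
import Summits.QuantumFields.YangMills.Theorems.WeakCouplingRatesColdBoxTwoPointFloorWStubBoxKernelVsLattice
import Summits.QuantumFields.YangMills.Theorems.WeakCouplingRatesColdBoxTwoPointFloorStubBoxGaussianWick
import Summits.QuantumFields.YangMills.Theorems.EquipartitionCriticalityFreeEnergyLogCoefficientStubExpChartPackage
import Summits.QuantumFields.YangMills.Theorems.BalabanLadderNTOnePointFloor
import Summits.QuantumFields.YangMills.Theorems.ColdBoxAllGroupsBoxFloorAllGroupsLargeFieldG
import Summits.QuantumFields.YangMills.Theorems.ColdBoxAllGroupsBoxFloorAllGroupsStubBoxGaussianDominationGOfAbs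
import Summits.QuantumFields.YangMills.Theorems.ColdBoxAllGroupsBoxFloorAllGroupsStubBoxDirichletDominationAbsG

/-!
# Skeleton for crux `BoxFloorAllGroups` (stmt-QuantumFields-22254) of route `ColdBoxAllGroups` — `Lines/birth.lean`, v6 (lead; SORRY-FREE)

Lead `ym-line-cbag-p1` (2026-08-27), reshaping the planner's v3 (ideator `ym-idea-2`).  Template: the PROVED `SU(2)` crux
`ColdBoxTwoPointFloorW` (`Cruxes/ColdBoxTwoPointFloorW/Lines/birth.lean`; S3a `stub_boxGaussianWick`, S3c
`stub_boxGaussianDomination`, S4 `stub_boxKernelVsLattice` all landed; crux proved p480280).  The group enters ONLY through S3c;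
S3a and S4 are statements about the free comb-gauge Maxwell field and are consumed here BY NAME.

## Reshape v3 → v4 (why)
* v3's stub D2 `stub_expChartPackage2 : ExpChartPackage2` (support item stmt-QuantumFields-22893) is DROPPED from the composition:
  its clause (c) (Haar = `c_H·J·Lebesgue` with a CONTINUOUS Jacobian `|J − 1| ≤ C₂|a|²`) is not what the covariance argument uses and is
  the most expensive clause to formalise (it needs the smooth structure of the abstract compact group).  The one-scale expansion only needs
  (i) the landed SOFT package `FreeEnergyLogCoefficient.stub_expChartPackage` (local surjectivity/injectivity of `expChart`, and the two-sided
  Haar-vs-Lebesgue sandwich `c_H κE(r)^{−D} vol ≤ ν ≤ c_H vol` on chart balls — an a.e.-bounded DENSITY whose logarithm `∈ [−16Dr, 0]` per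
  link is summable over the `≍ β^{4θ}` links: `β^{4θ}·D·r → 0` for `r ≍ H²β^{ε−1/2}`), and (ii) the second-order COST expansion
  `N − Re tr U = ½‖U − 1‖_F²`, `‖e^X − 1 − X‖ ≤ C‖X‖²` (cubic plaquette remainder, no BCH).  Both are proved inline in the helper files.
* v3's S3c-G is split along the SU(2) architecture into three registered stubs stated in EXISTING tree vocabulary:
  S1 (large fields are rare in the cold box, every `G`), S2 (the ABSOLUTE one-scale comparison with the box's own temporal-gauge
  Dirichlet Gaussian, `D/4 · boxDirCircSqCov`, given S1), S3 (absolute Dirichlet form ⇒ relative free form, port of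
  `stub_boxGaussianDomination_of_abs` with `¾ ↦ D/4`).  S2 is the load-bearing stub; its internal objects (exp-chart configuration,
  `D` colour copies of `boxDirichlet`, tilt) live in helper files landed `--supports` and will be exposed as further registered stubs
  (v5) once their definitions file is in the tree.

## v5 (2026-08-27T22:45Z): S1 and S3 CLOSED by landed theorems
* S1 `stub_boxLargeFieldRarityG` := `Theorems.ColdBoxAllGroups.stub_boxLargeFieldRarityG` (width seat w3, p578762,
  `Theorems/ColdBoxAllGroupsBoxFloorAllGroupsLargeFieldG.lean`);
* S3 `stub_boxGaussianDominationG_of_abs` := `Theorems.ColdBoxAllGroups.stub_boxGaussianDominationG_of_abs` (lead worker, p580286,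
  `Theorems/ColdBoxAllGroupsBoxFloorAllGroupsStubBoxGaussianDominationGOfAbs.lean`);
* v6: S2 CLOSED := `Theorems.ColdBoxAllGroups.stub_boxDirichletDominationAbsG` (lead p585121, assembly of CoreG/RepresentationGBall/GoodReductionG/ChartWindowG/ChartDensityJ/ExponentsG). History — landed bricks: `…OneScaleDefs` (objects, p579225), `…LinkSmallG` (w3), `…CubicG` (w3), `…GaussSideD` (p579837),
  `…TiltBoundG` (p580240), `…GaussTailD` (p580572 pending); `…ExpChartPackage2{AB,Haar}` + `stub_expChartPackage2` (w2, item 22893 proved) supply the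
  exact chart density `J`; remaining: B2 GoodReductionG + B4 RepresentationG (w3), B9 core + assembly (lead).

## Stubs (v4 signatures, unchanged)
* **S1 `stub_boxLargeFieldRarityG`** (size M): for `0 < θ`, `2θ < ε`, eventually in `β`, `boxState r.ρ β ⌈β^θ⌉ {∃ p touching Λ :
  N − Re tr r(U_p) ≥ β^{2ε−1}} ≤ exp(−β^ε)` — port of `boxState_largeField_rarity` (Gibbs–Laplace bound `ymSpecification_one_real_le`,
  model-generic, + the soft small-ball bound `exists_haar_gball_ge` of the exp chart, exponent `D = dimE r.ρ`).
* **S2 `stub_boxDirichletDominationAbsG`** (LOAD-BEARING, size XL): S1 ⇒ for every `(G, r)` there are `θ₀ > 0` and, for `0 < θ ≤ θ₀`,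
  `κ > 8θ` with: eventually in `β`, for all `T ≤ H = ⌈β^θ⌉`,
  `|β²·boxPlaqCov r.ρ β H T − (D/4)·boxDirCircSqCov H T| ≤ β^{−κ}` — the one-scale Laplace expansion in the temporal-forest gauge and the
  exponential chart (SU(2) instance: `boxDirichletDominationAbs`, `θ₀ = 1/100`, `κ = 9θ`).
* **S3 `stub_boxGaussianDominationG_of_abs`** (size M): S2's conclusion ⇒ the relative free form
  `|β²·boxPlaqCov − (D/4)·boxCircSqCov| ≤ (1/8)·boxCircSqCov` at `T = ⌈β^A⌉`, `0 < A < θ ≤ θ₀` (kernel comparisons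
  `exists_boxDirichletPlaqCov_sub_bound`, `exists_boxMaxwellPlaqCov_sub_bound`, `exists_curvaturePlaquetteCorr_asymp`, Wick identities;
  precision scaled by `D`).
* `stub_dimE_pos` — CLOSED by the tree (`Cruxes.NT.LinkEquipartition.dimE_pos_of_isCompactSimpleLieGroup`).
* `BoxFloorAllGroups_of` — composition, kernel-checked: `(D/4 − 1/8)·2Π² ≥ Π²/4 ≥ (c₁²/4)·C(T)²`, `c = c₁²/4`.
-/

set_option autoImplicit false

noncomputable section

namespace Summit.QuantumFields.YangMills.Cruxes.BoxFloorAllGroups.Birth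

open scoped Matrix.Norms.Frobenius ENNReal NNReal
open MeasureTheory
open Literature.MathematicalPhysics.QuantumFieldTheory Literature.MathematicalPhysics.QuantumLattice
open Summit.QuantumFields.YangMills.Theorems.WeakCouplingRates
open Summit.QuantumFields.YangMills.Theorems.FreeEnergyLogCoefficient (dimE lieIso expChart)
open Summit.QuantumFields.YangMills.Theses.ColdBoxAllGroups (BoxFloorAllGroups)

/-- **S1 (CLOSED, w3 p578762) — large fields are rare in the cold-wall box, every compact simple `G`.**  For `0 < θ`, `2θ < ε`: eventually in `β`,
the `boxState r.ρ β ⌈β^θ⌉`-probability that some plaquette touching `Λ = boxEdges 4 (2⌈β^θ⌉+1)` costs `N − Re tr r(U_p) ≥ β^{2ε−1}` is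
`≤ exp(−β^ε)`. -/
theorem stub_boxLargeFieldRarityG :
    ∀ (G : Type) [Group G] [TopologicalSpace G] [IsTopologicalGroup G] [CompactSpace G],
    IsCompactSimpleLieGroup G →
    letI : MeasurableSpace G := borel G
    haveI : BorelSpace G := ⟨rfl⟩
    ∀ r : LatticeRep G, ∀ θ ε : ℝ, 0 < θ → 2 * θ < ε → ∃ β₀ : ℝ, ∀ β : ℝ, β₀ ≤ β →
      (boxState r.ρ β ⌈β ^ θ⌉₊).real
          {U | ∃ p ∈ plaquettesTouching (AxialGauge.boxEdges 4 (2 * ⌈β ^ θ⌉₊ + 1)),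
            β ^ (2 * ε - 1) ≤ (r.N : ℝ) - plaquetteObs r.ρ p.1 p.2.1.1 p.2.1.2 U} ≤ Real.exp (-(β ^ ε)) :=
  Summit.QuantumFields.YangMills.Theorems.ColdBoxAllGroups.stub_boxLargeFieldRarityG

/-- **S2 (CLOSED, lead p585121; load-bearing) — the ABSOLUTE one-scale comparison of the cold-wall box with its own temporal-gauge Dirichlet
Gaussian, every compact simple `G`**, given S1: there is `θ₀ > 0` such that for `0 < θ ≤ θ₀` some `κ > 8θ` satisfies, eventually in `β`,
for every `T ≤ H = ⌈β^θ⌉`: `|β²·boxPlaqCov r.ρ β H T − (D/4)·boxDirCircSqCov H T| ≤ β^{−κ}`, `D = dimE r.ρ`. -/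
theorem stub_boxDirichletDominationAbsG :
    (∀ (G : Type) [Group G] [TopologicalSpace G] [IsTopologicalGroup G] [CompactSpace G],
      IsCompactSimpleLieGroup G →
      letI : MeasurableSpace G := borel G
      haveI : BorelSpace G := ⟨rfl⟩
      ∀ r : LatticeRep G, ∀ θ ε : ℝ, 0 < θ → 2 * θ < ε → ∃ β₀ : ℝ, ∀ β : ℝ, β₀ ≤ β →
        (boxState r.ρ β ⌈β ^ θ⌉₊).real
            {U | ∃ p ∈ plaquettesTouching (AxialGauge.boxEdges 4 (2 * ⌈β ^ θ⌉₊ + 1)),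
              β ^ (2 * ε - 1) ≤ (r.N : ℝ) - plaquetteObs r.ρ p.1 p.2.1.1 p.2.1.2 U} ≤ Real.exp (-(β ^ ε))) →
    ∀ (G : Type) [Group G] [TopologicalSpace G] [IsTopologicalGroup G] [CompactSpace G],
    IsCompactSimpleLieGroup G →
    letI : MeasurableSpace G := borel G
    haveI : BorelSpace G := ⟨rfl⟩
    ∀ r : LatticeRep G, ∃ θ₀ : ℝ, 0 < θ₀ ∧ ∀ θ : ℝ, 0 < θ → θ ≤ θ₀ → ∃ κ : ℝ, 8 * θ < κ ∧ ∃ β₀ : ℝ, ∀ β : ℝ, β₀ ≤ β →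
      ∀ T : ℕ, T ≤ ⌈β ^ θ⌉₊ →
        |β ^ 2 * boxPlaqCov r.ρ β ⌈β ^ θ⌉₊ T - (dimE r.ρ : ℝ) / 4 * boxDirCircSqCov ⌈β ^ θ⌉₊ T| ≤ β ^ (-κ) :=
  Summit.QuantumFields.YangMills.Theorems.ColdBoxAllGroups.stub_boxDirichletDominationAbsG

/-- **S3 (CLOSED, lead worker p580286) — the absolute Dirichlet comparison implies the relative free form**, every compact simple `G`: from S2's conclusion,
there is `θ₀ > 0` such that for all `0 < A < θ ≤ θ₀`, eventually in `β`,
`|β²·boxPlaqCov r.ρ β ⌈β^θ⌉ ⌈β^A⌉ − (D/4)·boxCircSqCov| ≤ (1/8)·boxCircSqCov` (port of `stub_boxGaussianDomination_of_abs`, `¾ ↦ D/4`,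
kernel precision scaled by `D`). -/
theorem stub_boxGaussianDominationG_of_abs :
    (∀ (G : Type) [Group G] [TopologicalSpace G] [IsTopologicalGroup G] [CompactSpace G],
      IsCompactSimpleLieGroup G →
      letI : MeasurableSpace G := borel G
      haveI : BorelSpace G := ⟨rfl⟩
      ∀ r : LatticeRep G, ∃ θ₀ : ℝ, 0 < θ₀ ∧ ∀ θ : ℝ, 0 < θ → θ ≤ θ₀ → ∃ κ : ℝ, 8 * θ < κ ∧ ∃ β₀ : ℝ, ∀ β : ℝ, β₀ ≤ β →
        ∀ T : ℕ, T ≤ ⌈β ^ θ⌉₊ →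
          |β ^ 2 * boxPlaqCov r.ρ β ⌈β ^ θ⌉₊ T - (dimE r.ρ : ℝ) / 4 * boxDirCircSqCov ⌈β ^ θ⌉₊ T| ≤ β ^ (-κ)) →
    ∀ (G : Type) [Group G] [TopologicalSpace G] [IsTopologicalGroup G] [CompactSpace G],
    IsCompactSimpleLieGroup G →
    letI : MeasurableSpace G := borel G
    haveI : BorelSpace G := ⟨rfl⟩
    ∀ r : LatticeRep G, ∃ θ₀ : ℝ, 0 < θ₀ ∧ ∀ A θ : ℝ, 0 < A → A < θ → θ ≤ θ₀ → ∃ β₀ : ℝ, ∀ β : ℝ, β₀ ≤ β →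
      |β ^ 2 * boxPlaqCov r.ρ β ⌈β ^ θ⌉₊ ⌈β ^ A⌉₊ - (dimE r.ρ : ℝ) / 4 * boxCircSqCov ⌈β ^ θ⌉₊ ⌈β ^ A⌉₊| ≤
        1 / 8 * boxCircSqCov ⌈β ^ θ⌉₊ ⌈β ^ A⌉₊ :=
  Summit.QuantumFields.YangMills.Theorems.ColdBoxAllGroups.stub_boxGaussianDominationG_of_abs

/-- **Stub — the Lie algebra of a compact simple linear group is non-zero** (`D = dimE r.ρ ≥ 1`).
CLOSED by the tree theorem `Cruxes.NT.LinkEquipartition.dimE_pos_of_isCompactSimpleLieGroup` (module `BalabanLadderNTOnePointFloor`). -/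
theorem stub_dimE_pos : ∀ (G : Type) [Group G] [TopologicalSpace G] [IsTopologicalGroup G] [CompactSpace G],
    IsCompactSimpleLieGroup G → ∀ r : LatticeRep G, 1 ≤ dimE r.ρ :=
  fun G _ _ _ _ hG r => Nat.succ_le_of_lt
    (Summit.QuantumFields.YangMills.Cruxes.NT.LinkEquipartition.dimE_pos_of_isCompactSimpleLieGroup G r hG)

/-! ## Composition (kernel-checked): dimE_pos ∧ (S3 (S2 S1)) (∧ tree S3a, S4) ⇒ the crux BY NAME -/

/-- **Composition.**  From `1 ≤ D` and the relative Gaussian domination (the output of S3 ∘ S2 ∘ S1): the crux, with `c = c₁²/4`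
(`c₁` from S4 `stub_boxKernelVsLattice`), via S3a `stub_boxGaussianWick` (`boxCircSqCov = 2·boxMaxwellPlaqCov²`):
`β²Cov ≥ (D/4 − 1/8)·2Π² ≥ Π²/4 ≥ (c₁²/4)·C(T)²`. -/
theorem BoxFloorAllGroups_of
    (hdim : ∀ (G : Type) [Group G] [TopologicalSpace G] [IsTopologicalGroup G] [CompactSpace G],
      IsCompactSimpleLieGroup G → ∀ r : LatticeRep G, 1 ≤ dimE r.ρ)
    (hdom : ∀ (G : Type) [Group G] [TopologicalSpace G] [IsTopologicalGroup G] [CompactSpace G],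
      IsCompactSimpleLieGroup G →
      letI : MeasurableSpace G := borel G
      haveI : BorelSpace G := ⟨rfl⟩
      ∀ r : LatticeRep G, ∃ θ₀ : ℝ, 0 < θ₀ ∧ ∀ A θ : ℝ, 0 < A → A < θ → θ ≤ θ₀ → ∃ β₀ : ℝ, ∀ β : ℝ, β₀ ≤ β →
        |β ^ 2 * boxPlaqCov r.ρ β ⌈β ^ θ⌉₊ ⌈β ^ A⌉₊ - (dimE r.ρ : ℝ) / 4 * boxCircSqCov ⌈β ^ θ⌉₊ ⌈β ^ A⌉₊| ≤
          1 / 8 * boxCircSqCov ⌈β ^ θ⌉₊ ⌈β ^ A⌉₊) :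
    BoxFloorAllGroups := by
  intro G _ _ _ _ hG
  letI : MeasurableSpace G := borel G
  haveI : BorelSpace G := ⟨rfl⟩
  intro r
  obtain ⟨θ₀, hθ₀, hwin⟩ := hdom G hG r
  have hD : (1 : ℝ) ≤ (dimE r.ρ : ℝ) := by exact_mod_cast hdim G hG r
  refine ⟨θ₀, hθ₀, fun A θ hA hAθ hθ => ?_⟩
  obtain ⟨β₀, h₀⟩ := hwin A θ hA hAθ hθ
  obtain ⟨c₁, hc₁, β₁, h₁⟩ := stub_boxKernelVsLattice A θ hA hAθ
  refine ⟨c₁ ^ 2 / 4, by positivity, max β₀ β₁, fun β hβ => ?_⟩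
  have h0 := (abs_le.1 (h₀ β (le_trans (le_max_left _ _) hβ))).1
  have h1 := h₁ β (le_trans (le_max_right _ _) hβ)
  have hW := stub_boxGaussianWick ⌈β ^ θ⌉₊ ⌈β ^ A⌉₊
  set P := boxMaxwellPlaqCov ⌈β ^ θ⌉₊ ⌈β ^ A⌉₊ with hP
  set S := boxCircSqCov ⌈β ^ θ⌉₊ ⌈β ^ A⌉₊ with hS
  have hS2 : S = 2 * P ^ 2 := hW
  have hPsq : 0 ≤ P ^ 2 := sq_nonneg _
  have h1' : (c₁ * |curvaturePlaquetteCorr (d := 4) (by norm_num) (⌈β ^ A⌉₊ : ℤ)|) ^ 2 ≤ |P| ^ 2 :=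
    pow_le_pow_left₀ (by positivity) h1 2
  rw [sq_abs, mul_pow, sq_abs] at h1'
  -- floor: β²Cov ≥ (D/4 − 1/8)·S = (D/2 − 1/4)·Π² ≥ Π²/4 ≥ (c₁²/4)·C²
  have hmain : (1 / 4 : ℝ) * P ^ 2 ≤ β ^ 2 * boxPlaqCov r.ρ β ⌈β ^ θ⌉₊ ⌈β ^ A⌉₊ := by
    have : ((dimE r.ρ : ℝ) / 4 - 1 / 8) * S ≤ β ^ 2 * boxPlaqCov r.ρ β ⌈β ^ θ⌉₊ ⌈β ^ A⌉₊ := by linarith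
    rw [hS2] at this
    nlinarith
  calc c₁ ^ 2 / 4 * curvaturePlaquetteCorr (d := 4) (by norm_num) (⌈β ^ A⌉₊ : ℤ) ^ 2
      = (1 / 4 : ℝ) * (c₁ ^ 2 * curvaturePlaquetteCorr (d := 4) (by norm_num) (⌈β ^ A⌉₊ : ℤ) ^ 2) := by ring
    _ ≤ (1 / 4 : ℝ) * P ^ 2 := by gcongr
    _ ≤ _ := hmain

/-- The crux BY NAME from the stubs: `dimE_pos` and `S3 (S2 S1)`. -/
theorem BoxFloorAllGroups_holds_of_stubs : BoxFloorAllGroups :=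
  BoxFloorAllGroups_of stub_dimE_pos
    (stub_boxGaussianDominationG_of_abs (stub_boxDirichletDominationAbsG stub_boxLargeFieldRarityG))

end Summit.QuantumFields.YangMills.Cruxes.BoxFloorAllGroups.Birth

end
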